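import HarnessLib
import Summits.Ventures.QEC.Census.CertCheckBZ
import Summits.Ventures.QEC.Census.CertCheckMitmFast
import Summits.Ventures.QEC.Census.CertCheckParityFast
import Summits.Ventures.QEC.Census.RankCert

/-!
# Census rows, batch `CalibRows01` (2 rows of family dir `Calib`): `cal_Steane7`, `cal_Toric_3x3`

One section per row, each in its own namespace `Summit.Ventures.QEC.Census.<LeanName>` with the one-module certificate chain of
qec-search-7's `emit_row.py` (DistCert data as `maskOf` support lists; structural and rank checks through the fold-popcount twins of
`Census/CertCheckParityFast.lean` and their bridges; both distance sides by the meet-in-the-middle replay of `Census/CertCheckMitm.lean`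
on `scanF` against tables built in the kernel, `Census/CertCheckMitmFast.lean`; `isCode : (NAME.cert.code _).IsCode n k d`).
Batched per D-0064 (one proposal for several small rows); tier KERNEL-std: `decide +kernel` only, axioms ⊆ {propext, Classical.choice,
Quot.sound}. HONEST FRAMING: census-found / calibration codes; coverage and comparison sentences live in census/TABLE.tsv and FINDINGS.
-/

/-! ### Census row `cal_Steane7` (family calibration(search-2_gens, cell C.0*) is `[[7, 1, 3]]` — CERTIFIED, tier KERNEL-std
Source: `cert/search-2-c0-kernelA/cal_Steane7.certA.json` (certA=f6025bbc84a0f4ae, certB=B-Steane7-j256112, matrix_sha256 `ac0cb62124af1b5b…`).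
Same chain as every `emit_row.py` module: `checkStructure_ok` (fast twin + bridge), `mitmZ_ok`/`mitmX_ok` (meet-in-the-middle vs
kernel-built tables, `CertCheckMitmFast`), `dZ_eq`/`dX_eq`, rank certificates `rcX`/`rcZ` (+ `check_of_checkQ`), `k_eq`, **`isCode`**. -/

namespace Summit.Ventures.QEC.Census.cal_Steane7

open Matrix Literature.InformationTheory.QuantumCodes Summit.Ventures.QEC.Census

/-! ## Data: the certificate -/

/-- The distance certificate of census row `cal_Steane7` as a `DistCert` literal (certificate id `f6025bbc84a0f4ae`):
`n = 7`, `HX`/`HZ` = the 3 + 3 check rows, each the word `maskOf [support]` (bit `j` = qubit `j`; the supports are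
the rows of the generators file verbatim; words are built by the kernel — big decimal literals evaluate ≈ 50× slower in
kernel loops, qec-search-7 B-5), per side the claimed distance, the logical witness of that weight and its non-membership
witness (as `maskOf` support lists), and the EMPTY allow-list. -/
def cert : DistCert where
  n := 7
  HX := [
    maskOf [0, 2, 4, 6], maskOf [1, 2, 5, 6], maskOf [3, 4, 5, 6]]
  HZ := [
    maskOf [0, 2, 4, 6], maskOf [1, 2, 5, 6], maskOf [3, 4, 5, 6]]
  sideZ := { d := 3, witness := maskOf [0, 1, 2], nonmember := maskOf [0, 1, 2], found := [] }
  sideX := { d := 3, witness := maskOf [0, 1, 2], nonmember := maskOf [0, 1, 2], found := [] }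

/-! ## The checks (all `decide +kernel`: tier KERNEL) -/

/-- The structural check of the `cal_Steane7` certificate passes: commutation, both upper witnesses, (empty) allow-lists
(fast twin `checkStructureQ` by `decide +kernel`, then the bridge; `cert.n ≤ 496` by `decide`). -/
theorem checkStructure_ok : cal_Steane7.cert.checkStructure = true :=
  cal_Steane7.cert.checkStructure_of_checkStructureQ (by decide) (by decide +kernel)

/-- The commutation check (names the CSS code `cal_Steane7.cert.code cal_Steane7.commOK_cert`). -/
theorem commOK_cert : commOK cal_Steane7.cert.n cal_Steane7.cert.HX cal_Steane7.cert.HZ = true :=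
  cal_Steane7.cert.commOK_of_checkStructure cal_Steane7.checkStructure_ok

/-- Side `Z`: the meet-in-the-middle replay `wmax = 2 = 1 + 1` passes — the kernel builds the table of the
8 `Z`-patterns of weight ≤ 1 (keyed by `H^X`-syndrome) and probes every `Z`-pattern of weight ≤ 1 against it
(8 probes; `decide +kernel`). -/
theorem mitmZ_ok : cal_Steane7.cert.mitmZB 1 1 = true := by
  decide +kernel

/-- Side `X`: the meet-in-the-middle replay `wmax = 2 = 1 + 1` passes (8 tabled patterns, 8 probes;
`decide +kernel`). -/
theorem mitmX_ok : cal_Steane7.cert.mitmXB 1 1 = true := by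
  decide +kernel

/-! ## Distances -/

/-- **`d_Z = 3`** for census row `cal_Steane7` (CERTIFIED, tier KERNEL): witness of weight 3 and no `Z`-logical of
weight ≤ 2 (`DistCert.dZ_code_of_mitmB`). -/
theorem dZ_eq : (cal_Steane7.cert.code cal_Steane7.commOK_cert).dZ = 3 :=
  cal_Steane7.cert.dZ_code_of_mitmB cal_Steane7.checkStructure_ok cal_Steane7.mitmZ_ok

/-- **`d_X = 3`** for census row `cal_Steane7` (CERTIFIED, tier KERNEL; `DistCert.dX_code_of_mitmB`). -/
theorem dX_eq : (cal_Steane7.cert.code cal_Steane7.commOK_cert).dX = 3 :=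
  cal_Steane7.cert.dX_code_of_mitmB cal_Steane7.checkStructure_ok cal_Steane7.mitmX_ok

/-! ## Rank certificates and `k` -/

/-- Right-inverse columns 0…2 of the `H^X` rank certificate (supports as `maskOf`). -/
def rinvX_0 : List ℕ :=
  [
    maskOf [0], maskOf [1], maskOf [3]]

/-- Rank certificate of `H^X` (CERT-FORMAT §3: `r = 3`, pivot rows, right-inverse columns, dependent rows as
XORs of pivot rows by position; re-derived by the emitter, checked below). -/
def rcX : RankCert where
  r := 3
  pivots := [0, 1, 2]
  rinv := rinvX_0
  dependent := []

/-- Right-inverse columns 0…2 of the `H^Z` rank certificate (supports as `maskOf`). -/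
def rinvZ_0 : List ℕ :=
  [
    maskOf [0], maskOf [1], maskOf [3]]

/-- Rank certificate of `H^Z` (CERT-FORMAT §3: `r = 3`, pivot rows, right-inverse columns, dependent rows as
XORs of pivot rows by position; re-derived by the emitter, checked below). -/
def rcZ : RankCert where
  r := 3
  pivots := [0, 1, 2]
  rinv := rinvZ_0
  dependent := []

/-- The rank certificate of `H^X` passes the checker: `r = 3` (3 pivot rows, 0 dependent rows;
`Census/RankCert.lean`, via the fast twin `checkQ` by `decide +kernel` and the bridge `check_of_checkQ`). -/
theorem rankCertX_check : cal_Steane7.rcX.check cal_Steane7.cert.n cal_Steane7.cert.HX = true :=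
  RankCert.check_of_checkQ (by decide) (by decide +kernel)

/-- The rank certificate of `H^Z` passes the checker: `r = 3`. -/
theorem rankCertZ_check : cal_Steane7.rcZ.check cal_Steane7.cert.n cal_Steane7.cert.HZ = true :=
  RankCert.check_of_checkQ (by decide) (by decide +kernel)

/-- `rank H^X = 3` for census row `cal_Steane7` (CERTIFIED). -/
theorem rank_HX : (rowMatrix cal_Steane7.cert.n cal_Steane7.cert.HX).rank = 3 :=
  rank_rowMatrix_of_check cal_Steane7.rankCertX_check

/-- `rank H^Z = 3` for census row `cal_Steane7` (CERTIFIED). -/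
theorem rank_HZ : (rowMatrix cal_Steane7.cert.n cal_Steane7.cert.HZ).rank = 3 :=
  rank_rowMatrix_of_check cal_Steane7.rankCertZ_check

/-- **`k = 1`** for census row `cal_Steane7` (`k = n − rank H^X − rank H^Z = 7 − 3 − 3`, type-02's `CSSCode.k_eq`;
CERTIFIED). -/
theorem k_eq : (cal_Steane7.cert.code cal_Steane7.commOK_cert).k = 1 := by
  rw [CSSCode.k_eq, Fintype.card_fin]
  change cal_Steane7.cert.n - (rowMatrix cal_Steane7.cert.n cal_Steane7.cert.HX).rank - (rowMatrix cal_Steane7.cert.n cal_Steane7.cert.HZ).rank = 1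
  rw [cal_Steane7.rank_HX, cal_Steane7.rank_HZ]
  rfl

/-! ## The census row -/

/-- **Census row `cal_Steane7` is a `[[7, 1, 3]]` code** (census predicate `CSSCode.IsCode`, exact distance;
CERTIFIED, tier KERNEL-std). -/
theorem isCode : (cal_Steane7.cert.code cal_Steane7.commOK_cert).IsCode 7 1 3 := by
  have h := (cal_Steane7.cert.code cal_Steane7.commOK_cert).isCode_of_dX_dZ (by rw [cal_Steane7.k_eq]; decide) cal_Steane7.dX_eq cal_Steane7.dZ_eq
  rwa [cal_Steane7.k_eq, Fintype.card_fin] at h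

end Summit.Ventures.QEC.Census.cal_Steane7

/-! ### Census row `cal_Toric_3x3` (family calibration(search-2_gens, cell C.0*) is `[[18, 2, 3]]` — CERTIFIED, tier KERNEL-std
Source: `cert/search-2-c0-kernelA/cal_Toric_3x3.certA.json` (certA=12130ae99b4fa379, certB=B-Toric18-j256112, matrix_sha256 `04d1a9ca29732c88…`).
Same chain as every `emit_row.py` module: `checkStructure_ok` (fast twin + bridge), `mitmZ_ok`/`mitmX_ok` (meet-in-the-middle vs
kernel-built tables, `CertCheckMitmFast`), `dZ_eq`/`dX_eq`, rank certificates `rcX`/`rcZ` (+ `check_of_checkQ`), `k_eq`, **`isCode`**. -/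

namespace Summit.Ventures.QEC.Census.cal_Toric_3x3

open Matrix Literature.InformationTheory.QuantumCodes Summit.Ventures.QEC.Census

/-! ## Data: the certificate -/

/-- The distance certificate of census row `cal_Toric_3x3` as a `DistCert` literal (certificate id `12130ae99b4fa379`):
`n = 18`, `HX`/`HZ` = the 9 + 9 check rows, each the word `maskOf [support]` (bit `j` = qubit `j`; the supports are
the rows of the generators file verbatim; words are built by the kernel — big decimal literals evaluate ≈ 50× slower in
kernel loops, qec-search-7 B-5), per side the claimed distance, the logical witness of that weight and its non-membership
witness (as `maskOf` support lists), and the EMPTY allow-list. -/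
def cert : DistCert where
  n := 18
  HX := [
    maskOf [0, 3, 9, 10], maskOf [1, 4, 10, 11], maskOf [2, 5, 9, 11], maskOf [3, 6, 12, 13], maskOf [4, 7, 13, 14], maskOf [5, 8, 12, 14],
    maskOf [0, 6, 15, 16], maskOf [1, 7, 16, 17], maskOf [2, 8, 15, 17]]
  HZ := [
    maskOf [0, 2, 9, 15], maskOf [0, 1, 10, 16], maskOf [1, 2, 11, 17], maskOf [3, 5, 9, 12], maskOf [3, 4, 10, 13], maskOf [4, 5, 11, 14],
    maskOf [6, 8, 12, 15], maskOf [6, 7, 13, 16], maskOf [7, 8, 14, 17]]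
  sideZ := { d := 3, witness := maskOf [0, 3, 6], nonmember := maskOf [0, 1, 2], found := [] }
  sideX := { d := 3, witness := maskOf [0, 1, 2], nonmember := maskOf [0, 3, 6], found := [] }

/-! ## The checks (all `decide +kernel`: tier KERNEL) -/

/-- The structural check of the `cal_Toric_3x3` certificate passes: commutation, both upper witnesses, (empty) allow-lists
(fast twin `checkStructureQ` by `decide +kernel`, then the bridge; `cert.n ≤ 496` by `decide`). -/
theorem checkStructure_ok : cal_Toric_3x3.cert.checkStructure = true :=
  cal_Toric_3x3.cert.checkStructure_of_checkStructureQ (by decide) (by decide +kernel)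

/-- The commutation check (names the CSS code `cal_Toric_3x3.cert.code cal_Toric_3x3.commOK_cert`). -/
theorem commOK_cert : commOK cal_Toric_3x3.cert.n cal_Toric_3x3.cert.HX cal_Toric_3x3.cert.HZ = true :=
  cal_Toric_3x3.cert.commOK_of_checkStructure cal_Toric_3x3.checkStructure_ok

/-- Side `Z`: the meet-in-the-middle replay `wmax = 2 = 1 + 1` passes — the kernel builds the table of the
19 `Z`-patterns of weight ≤ 1 (keyed by `H^X`-syndrome) and probes every `Z`-pattern of weight ≤ 1 against it
(19 probes; `decide +kernel`). -/
theorem mitmZ_ok : cal_Toric_3x3.cert.mitmZB 1 1 = true := by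
  decide +kernel

/-- Side `X`: the meet-in-the-middle replay `wmax = 2 = 1 + 1` passes (19 tabled patterns, 19 probes;
`decide +kernel`). -/
theorem mitmX_ok : cal_Toric_3x3.cert.mitmXB 1 1 = true := by
  decide +kernel

/-! ## Distances -/

/-- **`d_Z = 3`** for census row `cal_Toric_3x3` (CERTIFIED, tier KERNEL): witness of weight 3 and no `Z`-logical of
weight ≤ 2 (`DistCert.dZ_code_of_mitmB`). -/
theorem dZ_eq : (cal_Toric_3x3.cert.code cal_Toric_3x3.commOK_cert).dZ = 3 :=
  cal_Toric_3x3.cert.dZ_code_of_mitmB cal_Toric_3x3.checkStructure_ok cal_Toric_3x3.mitmZ_ok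

/-- **`d_X = 3`** for census row `cal_Toric_3x3` (CERTIFIED, tier KERNEL; `DistCert.dX_code_of_mitmB`). -/
theorem dX_eq : (cal_Toric_3x3.cert.code cal_Toric_3x3.commOK_cert).dX = 3 :=
  cal_Toric_3x3.cert.dX_code_of_mitmB cal_Toric_3x3.checkStructure_ok cal_Toric_3x3.mitmX_ok

/-! ## Rank certificates and `k` -/

/-- Right-inverse columns 0…7 of the `H^X` rank certificate (supports as `maskOf`). -/
def rinvX_0 : List ℕ :=
  [
    maskOf [2, 9], maskOf [2, 9, 10], maskOf [2], maskOf [2, 3, 9],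
    maskOf [2, 4, 9, 10], maskOf [2, 5], maskOf [0, 2, 9], maskOf [1, 2, 9, 10]]

/-- Rank certificate of `H^X` (CERT-FORMAT §3: `r = 8`, pivot rows, right-inverse columns, dependent rows as
XORs of pivot rows by position; re-derived by the emitter, checked below). -/
def rcX : RankCert where
  r := 8
  pivots := [0, 1, 2, 3, 4, 5, 6, 7]
  rinv := rinvX_0
  dependent := [(8, [0, 1, 2, 3, 4, 5, 6, 7])]

/-- Right-inverse columns 0…7 of the `H^Z` rank certificate (supports as `maskOf`). -/
def rinvZ_0 : List ℕ :=
  [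
    maskOf [6, 7, 9, 12], maskOf [0, 6, 7, 9, 12], maskOf [0, 1, 6, 7, 9, 12], maskOf [6, 7, 12],
    maskOf [3, 6, 7, 12], maskOf [3, 4, 6, 7, 12], maskOf [6, 7], maskOf [7]]

/-- Rank certificate of `H^Z` (CERT-FORMAT §3: `r = 8`, pivot rows, right-inverse columns, dependent rows as
XORs of pivot rows by position; re-derived by the emitter, checked below). -/
def rcZ : RankCert where
  r := 8
  pivots := [0, 1, 2, 3, 4, 5, 6, 7]
  rinv := rinvZ_0
  dependent := [(8, [0, 1, 2, 3, 4, 5, 6, 7])]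

/-- The rank certificate of `H^X` passes the checker: `r = 8` (8 pivot rows, 1 dependent rows;
`Census/RankCert.lean`, via the fast twin `checkQ` by `decide +kernel` and the bridge `check_of_checkQ`). -/
theorem rankCertX_check : cal_Toric_3x3.rcX.check cal_Toric_3x3.cert.n cal_Toric_3x3.cert.HX = true :=
  RankCert.check_of_checkQ (by decide) (by decide +kernel)

/-- The rank certificate of `H^Z` passes the checker: `r = 8`. -/
theorem rankCertZ_check : cal_Toric_3x3.rcZ.check cal_Toric_3x3.cert.n cal_Toric_3x3.cert.HZ = true :=
  RankCert.check_of_checkQ (by decide) (by decide +kernel)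

/-- `rank H^X = 8` for census row `cal_Toric_3x3` (CERTIFIED). -/
theorem rank_HX : (rowMatrix cal_Toric_3x3.cert.n cal_Toric_3x3.cert.HX).rank = 8 :=
  rank_rowMatrix_of_check cal_Toric_3x3.rankCertX_check

/-- `rank H^Z = 8` for census row `cal_Toric_3x3` (CERTIFIED). -/
theorem rank_HZ : (rowMatrix cal_Toric_3x3.cert.n cal_Toric_3x3.cert.HZ).rank = 8 :=
  rank_rowMatrix_of_check cal_Toric_3x3.rankCertZ_check

/-- **`k = 2`** for census row `cal_Toric_3x3` (`k = n − rank H^X − rank H^Z = 18 − 8 − 8`, type-02's `CSSCode.k_eq`;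
CERTIFIED). -/
theorem k_eq : (cal_Toric_3x3.cert.code cal_Toric_3x3.commOK_cert).k = 2 := by
  rw [CSSCode.k_eq, Fintype.card_fin]
  change cal_Toric_3x3.cert.n - (rowMatrix cal_Toric_3x3.cert.n cal_Toric_3x3.cert.HX).rank - (rowMatrix cal_Toric_3x3.cert.n cal_Toric_3x3.cert.HZ).rank = 2
  rw [cal_Toric_3x3.rank_HX, cal_Toric_3x3.rank_HZ]
  rfl

/-! ## The census row -/

/-- **Census row `cal_Toric_3x3` is a `[[18, 2, 3]]` code** (census predicate `CSSCode.IsCode`, exact distance;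
CERTIFIED, tier KERNEL-std). -/
theorem isCode : (cal_Toric_3x3.cert.code cal_Toric_3x3.commOK_cert).IsCode 18 2 3 := by
  have h := (cal_Toric_3x3.cert.code cal_Toric_3x3.commOK_cert).isCode_of_dX_dZ (by rw [cal_Toric_3x3.k_eq]; decide) cal_Toric_3x3.dX_eq cal_Toric_3x3.dZ_eq
  rwa [cal_Toric_3x3.k_eq, Fintype.card_fin] at h

end Summit.Ventures.QEC.Census.cal_Toric_3x3
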